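import Literature.Geometry.Riemannian.LinearHeatWeakExistence
import Literature.Geometry.Riemannian.LinearHeatVeryWeakClassical
import Literature.Geometry.Lorentzian.GreenIdentityCompactSupport
import Literature.Geometry.Riemannian.ShrinkerEntropyProofs
import HarnessLib

/-!
# Smooth very weak solutions of the static linear heat equation on a complete manifold are classical
# (crux `EntropyRung.NoncompactShrinkerGap`, stmt-SmoothPoincare4-10868, line `collapsed-ends-usc`, v13)

Helper `helper_classicalOfVeryWeak_noncompact` of the registered stub `stub_compactSupportLSI`: the
non-compact, static-metric version of `linearHeat_classical_of_veryWeak_of_contMDiffOn`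
(`LinearHeatVeryWeakClassical.lean`, written for a closed manifold and a time-dependent family with its
density ratio). Let `(M, g)` be a Riemannian manifold modelled on `ℝⁿ` (Hausdorff, second countable, `T₃`
— NOT compact), `Q, G` smooth on `M × ℝ`, `T ⊆ ℝ` open and `v` smooth on `M × T` with
`∫ v (−∂ₛζ − Δ_g ζ(·, s) + Qζ) d(V_g ⊗ ds) = ∫ G ζ d(V_g ⊗ ds)` for every smooth compactly supported `ζ`
with `tsupport ζ ⊆ M × T`. Then `∂ₛv − Δ_g v(·, s) + Q v = G` pointwise on `M × T`.

Proof (as in the tree, the three compactness uses replaced): `V_g` is finite on compact sets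
(`isFiniteMeasureOnCompacts_riemVolume`), hence σ-finite on the second countable, locally compact `M`
(Fubini); integration by parts in time is the compactly supported one on `ℝ`
(`integral_mul_deriv_eq_neg_of_tsupport_subset`); Green's identity in space is the one for a compactly
supported factor on a non-compact manifold (`GreenIdentityCompactSupport.lean`, both
`…_of_hasCompactSupport` and `…_of_hasCompactSupport_right`, applied to the slices `v(·, σ) ∈ C^∞` and
`ζ(·, σ) ∈ C^∞_c`); the conclusion is the fundamental lemma of the calculus of variations on the manifold
`M × ℝ` (`eqOn_zero_of_forall_integral_mul_contMDiff_eq_zero`). Everything is proved; no definitions.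

References: L. C. Evans, *Partial differential equations*, 2nd ed. (2010), §7.1.1; J. M. Lee,
*Introduction to Riemannian manifolds*, 2nd ed. (2018), Problem 2-23 (a).
-/

noncomputable section

set_option linter.dupNamespace false

open scoped Manifold ContDiff ENNReal NNReal Topology
open MeasureTheory Set Filter
open Literature.Geometry.Lorentzian Literature.Geometry.Riemannian

namespace Summit.SmoothPoincare4.SmoothPoincare4.Theorems.NoncompactShrinkerGapHeat

section ClassicalStatic

variable {n : ℕ} {M : Type*} [TopologicalSpace M] [T2Space M] [SecondCountableTopology M]
  [ChartedSpace (EuclideanSpace ℝ (Fin n)) M] [IsManifold (𝓡 n) ∞ M] [T3Space M] [MeasurableSpace M]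
  [BorelSpace M]
  {g : PseudoRiemannianMetric (𝓡 n) ∞ (EuclideanSpace ℝ (Fin n)) (TangentSpace (𝓡 n) : M → Type _)}

omit [SecondCountableTopology M] [ChartedSpace (EuclideanSpace ℝ (Fin n)) M] [IsManifold (𝓡 n) ∞ M]
  [T3Space M] [MeasurableSpace M] [BorelSpace M] [T2Space M] in
/-- A function continuous on an open set times a continuous function supported inside that set is
continuous on the whole space. [folklore] -/
private theorem continuous_mul_of_continuousOn_of_tsupport_subset_cs {X : Type*} [TopologicalSpace X]
    {O : Set X} (hO : IsOpen O) {E k : X → ℝ} (hE : ContinuousOn E O) (hk : Continuous k)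
    (hkO : tsupport k ⊆ O) : Continuous fun p ↦ E p * k p := by
  refine continuous_of_tsupport fun p hp ↦ ?_
  have hpO : p ∈ O := hkO (tsupport_mul_subset_right hp)
  exact ((hE.continuousWithinAt hpO).continuousAt (hO.mem_nhds hpO)).mul hk.continuousAt

omit [SecondCountableTopology M] [ChartedSpace (EuclideanSpace ℝ (Fin n)) M] [IsManifold (𝓡 n) ∞ M]
  [T3Space M] [MeasurableSpace M] [BorelSpace M] in
/-- The space slice at time `σ` of a compactly supported function on `M × ℝ` has compact support
(Hausdorff `M`). [folklore] -/
theorem hasCompactSupport_slice_space_cs {k : M × ℝ → ℝ} (hkc : HasCompactSupport k) (σ : ℝ) :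
    HasCompactSupport fun x ↦ k (x, σ) :=
  HasCompactSupport.of_support_subset_isCompact (hkc.isCompact.image continuous_fst)
    fun x hx ↦ ⟨(x, σ), subset_tsupport _ hx, rfl⟩

/-- **Green's identity for the Laplace–Beltrami operator with one compactly supported factor, on a
(non-compact) Riemannian manifold modelled on `ℝⁿ`**: `∫ u Δ_g w dV_g = ∫ w Δ_g u dV_g` for
`u ∈ C²(M)`, `w ∈ C²_c(M)` (both sides equal `−∫ g⁻¹(du, dw) dV_g`, by
`integral_mul_dalembertian_eq_neg_integral_innerDual_of_hasCompactSupport` and its `_right` version).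
[cite: Lee2018, Problem 2-23 (a)] -/
theorem integral_mul_laplaceBeltrami_comm_of_hasCompactSupport_cs (hg : g.IsRiemannian) {u w : M → ℝ}
    (hu : ContMDiff (𝓡 n) 𝓘(ℝ, ℝ) 2 u) (hw : ContMDiff (𝓡 n) 𝓘(ℝ, ℝ) 2 w) (hwc : HasCompactSupport w) :
    ∫ x, u x * g.laplaceBeltrami w x ∂g.riemVolume = ∫ x, w x * g.laplaceBeltrami u x ∂g.riemVolume := by
  haveI : LocallyCompactSpace M := ChartedSpace.locallyCompactSpace (EuclideanSpace ℝ (Fin n)) M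
  haveI := g.hasLeviCivita
  haveI := (PseudoRiemannianMetric.ofRiemannian (g.toContMDiffRiemannianMetric hg)).hasLeviCivita
  have h1le : (1 : ℕ∞ω) ≤ (2 : ℕ∞ω) := by norm_cast
  have h1 := integral_mul_dalembertian_eq_neg_integral_innerDual_of_hasCompactSupport_right
    (g.toContMDiffRiemannianMetric hg) (hu.of_le h1le) hw hwc
  have h2 := integral_mul_dalembertian_eq_neg_integral_innerDual_of_hasCompactSupport
    (g.toContMDiffRiemannianMetric hg) (hw.of_le h1le) hwc hu
  simp only [PseudoRiemannianMetric.laplaceBeltrami_eq_dalembertian]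
  rw [PseudoRiemannianMetric.riemVolume_eq hg]
  refine h1.trans (Eq.trans ?_ h2.symm)
  congr 1
  exact integral_congr_ae (Eventually.of_forall fun x ↦ PseudoRiemannianMetric.innerDual_comm _ x _ _)

/-- **Smooth very weak solutions of `∂ₛv − Δ_g v + Q v = G` on a complete manifold are classical
solutions.** `(M, g)` Riemannian modelled on `ℝⁿ` (Hausdorff, second countable, `T₃`, NOT compact), `Q, G`
smooth on `M × ℝ`, `T` open, `v` smooth on `M × T` with
`∫ v (−∂ₛζ − Δ_g ζ(·, s) + Qζ) d(V_g ⊗ ds) = ∫ G ζ d(V_g ⊗ ds)` for all smooth compactly supported `ζ`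
with `tsupport ζ ⊆ M × T`; then `∂ₛv − Δ_g v(·, s) + Qv = G` on `M × T` (integration by parts in time,
Green's identity with a compactly supported factor in space, Fubini for the σ-finite `V_g`, and the
fundamental lemma of the calculus of variations). [cite: Evans2010, §7.1.1] -/
theorem linearHeat_classical_of_veryWeak_static (hg : g.IsRiemannian) {Q G : ℝ → M → ℝ}
    (hQ : ContMDiff ((𝓡 n).prod 𝓘(ℝ, ℝ)) 𝓘(ℝ, ℝ) ∞ fun p : M × ℝ ↦ Q p.2 p.1)
    (hG : ContMDiff ((𝓡 n).prod 𝓘(ℝ, ℝ)) 𝓘(ℝ, ℝ) ∞ fun p : M × ℝ ↦ G p.2 p.1)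
    {T : Set ℝ} (hT : IsOpen T) {v : M × ℝ → ℝ}
    (hv : ContMDiffOn ((𝓡 n).prod 𝓘(ℝ, ℝ)) 𝓘(ℝ, ℝ) ∞ v (univ ×ˢ T))
    (hweak : ∀ ζ : M × ℝ → ℝ, ContMDiff ((𝓡 n).prod 𝓘(ℝ, ℝ)) 𝓘(ℝ, ℝ) ∞ ζ → HasCompactSupport ζ →
      tsupport ζ ⊆ univ ×ˢ T →
      ∫ p, v p * (-(deriv (fun s ↦ ζ (p.1, s)) p.2) - g.laplaceBeltrami (fun x ↦ ζ (x, p.2)) p.1 +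
          Q p.2 p.1 * ζ p) ∂(g.riemVolume.prod (volume : Measure ℝ)) =
        ∫ p, G p.2 p.1 * ζ p ∂(g.riemVolume.prod (volume : Measure ℝ))) :
    ∀ p ∈ univ ×ˢ T, deriv (fun s ↦ v (p.1, s)) p.2 -
      g.laplaceBeltrami (fun x ↦ v (x, p.2)) p.1 + Q p.2 p.1 * v p = G p.2 p.1 := by
  classical
  have h1le : (1 : ℕ∞ω) ≤ (∞ : ℕ∞ω) := WithTop.coe_le_coe.mpr le_top
  have h2le : (2 : ℕ∞ω) ≤ (∞ : ℕ∞ω) := WithTop.coe_le_coe.mpr le_top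
  -- topology and the reference measure (finite on compact sets, σ-finite, positive on open sets)
  haveI : LocallyCompactSpace M := ChartedSpace.locallyCompactSpace (EuclideanSpace ℝ (Fin n)) M
  set μ₀ : Measure M := g.riemVolume with hμ₀
  haveI : IsFiniteMeasureOnCompacts μ₀ := CarrilloNi2009_shrinkerLSI.isFiniteMeasureOnCompacts_riemVolume hg
  haveI : μ₀.IsOpenPosMeasure := by
    rw [hμ₀, PseudoRiemannianMetric.riemVolume_eq hg]
    exact isOpenPosMeasure_riemannianMeasure _
  haveI : (μ₀.prod (volume : Measure ℝ)).IsOpenPosMeasure := Measure.prod.instIsOpenPosMeasure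
  have hO : IsOpen ((univ : Set M) ×ˢ T) := isOpen_univ.prod hT
  have hfam : IsContMDiffFamilyOn ∞ (fun _ : ℝ ↦ g) univ := isContMDiffFamilyOn_const g univ
  -- continuity data of `v`: `v`, `∂ₛv`, `Δv` on `M × T`; slices
  have hvc : ContinuousOn v (univ ×ˢ T) := hv.continuousOn
  have hDv : ContinuousOn (fun p : M × ℝ ↦ deriv (fun s ↦ v (p.1, s)) p.2) (univ ×ˢ T) := by
    have h1 := Literature.Geometry.Manifold.contMDiffOn_derivWithin_time (I := 𝓡 n)
      (u := fun s x ↦ v (x, s)) hT.uniqueDiffOn hv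
    refine h1.continuousOn.congr fun p hp ↦ ?_
    simp only
    rw [derivWithin_of_isOpen hT hp.2]
  have hLv : ContinuousOn (fun p : M × ℝ ↦ g.laplaceBeltrami (fun x ↦ v (x, p.2)) p.1) (univ ×ˢ T) :=
    ((hfam.mono (subset_univ T)).contMDiffOn_laplaceBeltrami hT.uniqueDiffOn
      (f := fun s x ↦ v (x, s)) hv).continuousOn
  have hvslice : ∀ σ ∈ T, ContMDiff (𝓡 n) 𝓘(ℝ, ℝ) ∞ fun x ↦ v (x, σ) := fun σ hσ ↦
    hv.comp_contMDiff (contMDiff_id.prodMk contMDiff_const) fun x ↦ ⟨mem_univ _, hσ⟩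
  have hvderiv : ∀ y, ∀ σ ∈ T, HasDerivAt (fun s ↦ v (y, s)) (deriv (fun s ↦ v (y, s)) σ) σ := by
    intro y σ hσ
    have h1 : ContMDiffAt ((𝓡 n).prod 𝓘(ℝ, ℝ)) 𝓘(ℝ, ℝ) ∞ v (y, σ) :=
      (hv _ ⟨mem_univ _, hσ⟩).contMDiffAt (hO.mem_nhds ⟨mem_univ _, hσ⟩)
    have h2 : ContMDiffAt 𝓘(ℝ, ℝ) 𝓘(ℝ, ℝ) ∞ (fun s ↦ v (y, s)) σ :=
      h1.comp σ (contMDiffAt_const.prodMk contMDiffAt_id)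
    exact (h2.contDiffAt.differentiableAt (by simp)).hasDerivAt
  -- the continuous function which will be shown to vanish
  set W : M × ℝ → ℝ := fun p ↦ deriv (fun s ↦ v (p.1, s)) p.2 -
    g.laplaceBeltrami (fun x ↦ v (x, p.2)) p.1 + Q p.2 p.1 * v p - G p.2 p.1 with hW
  have hWc : ContinuousOn W (univ ×ˢ T) :=
    ((hDv.sub hLv).add (hQ.continuous.continuousOn.mul hvc)).sub hG.continuous.continuousOn
  suffices hW0 : ∀ p ∈ univ ×ˢ T, W p = 0 by
    intro p hp
    have h1 := hW0 p hp
    rw [hW] at h1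
    simp only at h1
    linarith
  refine eqOn_zero_of_forall_integral_mul_contMDiff_eq_zero (J := (𝓡 n).prod 𝓘(ℝ, ℝ))
    (μ₀.prod (volume : Measure ℝ)) hO hWc fun ζ hζ hζc hζT _ ↦ ?_
  /- the identity `∫ W ζ = 0` for a test function `ζ` -/
  have hζc' : Continuous ζ := hζ.continuous
  have hζslice : ∀ σ, ContMDiff (𝓡 n) 𝓘(ℝ, ℝ) ∞ fun x ↦ ζ (x, σ) := fun σ ↦
    hζ.comp (contMDiff_id.prodMk contMDiff_const)
  have hζzero : ∀ p, p ∉ tsupport ζ → ζ =ᶠ[𝓝 p] 0 := fun p hp ↦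
    notMem_tsupport_iff_eventuallyEq.1 hp
  have hζT' : ∀ σ, σ ∉ T → ∀ y, ζ (y, σ) = 0 := fun σ hσ y ↦
    image_eq_zero_of_notMem_tsupport fun hm ↦ hσ (hζT hm).2
  -- the time derivative `kt` and the space term `kx`
  set kt : M × ℝ → ℝ := fun p ↦ deriv (fun s ↦ ζ (p.1, s)) p.2 with hkt
  have hktc : Continuous kt := (contMDiff_deriv_time hζ).continuous
  have hktsupp : Function.support kt ⊆ tsupport ζ := by
    intro p hp
    by_contra hnot
    have e0 : (fun s ↦ ζ (p.1, s)) =ᶠ[𝓝 p.2] fun _ ↦ (0 : ℝ) := by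
      have e1 := eventuallyEq_zero_comp_of_eventuallyEq_zero (ι := fun s : ℝ ↦ ((p.1, s) : M × ℝ))
        (continuous_const.prodMk continuous_id) (y := p.2) (hζzero p hnot)
      filter_upwards [e1] with s hs
      simpa only [Pi.zero_apply] using hs
    refine hp ?_
    rw [hkt]
    simp only
    rw [e0.deriv_eq]
    exact deriv_const p.2 0
  have hktT : tsupport kt ⊆ univ ×ˢ T :=
    (closure_minimal hktsupp (isClosed_tsupport ζ)).trans hζT
  have hktcs : HasCompactSupport kt := hζc.mono' hktsupp
  set kx : M × ℝ → ℝ := fun p ↦ g.laplaceBeltrami (fun x ↦ ζ (x, p.2)) p.1 with hkx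
  have hkxc : Continuous kx := (contMDiff_laplaceBeltrami_family hfam hζ).continuous
  have hkxsupp : Function.support kx ⊆ tsupport ζ := by
    intro p hp
    by_contra hnot
    have e0 : (fun x ↦ ζ (x, p.2)) =ᶠ[𝓝 p.1] fun _ ↦ (0 : ℝ) :=
      eventuallyEq_zero_comp_of_eventuallyEq_zero (ι := fun x : M ↦ ((x, p.2) : M × ℝ))
        (continuous_id.prodMk continuous_const) (y := p.1) (hζzero p hnot)
    refine hp ?_
    rw [hkx]
    simp only
    rw [laplaceBeltrami_eq_zero_of_eventuallyEq_zero _ e0]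
  have hkxT : tsupport kx ⊆ univ ×ˢ T :=
    (closure_minimal hkxsupp (isClosed_tsupport ζ)).trans hζT
  have hkxcs : HasCompactSupport kx := hζc.mono' hkxsupp
  -- integrability of the space-time integrands
  have hI1 : Integrable (fun p ↦ v p * kt p) (μ₀.prod (volume : Measure ℝ)) :=
    (continuous_mul_of_continuousOn_of_tsupport_subset_cs hO hvc hktc hktT)
      |>.integrable_of_hasCompactSupport hktcs.mul_left
  have hI2 : Integrable (fun p : M × ℝ ↦ deriv (fun s ↦ v (p.1, s)) p.2 * ζ p)
      (μ₀.prod (volume : Measure ℝ)) :=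
    (continuous_mul_of_continuousOn_of_tsupport_subset_cs hO hDv hζc' hζT)
      |>.integrable_of_hasCompactSupport hζc.mul_left
  have hI3 : Integrable (fun p ↦ v p * kx p) (μ₀.prod (volume : Measure ℝ)) :=
    (continuous_mul_of_continuousOn_of_tsupport_subset_cs hO hvc hkxc hkxT)
      |>.integrable_of_hasCompactSupport hkxcs.mul_left
  have hI4 : Integrable (fun p : M × ℝ ↦ g.laplaceBeltrami (fun x ↦ v (x, p.2)) p.1 * ζ p)
      (μ₀.prod (volume : Measure ℝ)) :=
    (continuous_mul_of_continuousOn_of_tsupport_subset_cs hO hLv hζc' hζT)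
      |>.integrable_of_hasCompactSupport hζc.mul_left
  have hI5 : Integrable (fun p : M × ℝ ↦ v p * (Q p.2 p.1 * ζ p)) (μ₀.prod (volume : Measure ℝ)) := by
    have hs : tsupport (fun p : M × ℝ ↦ Q p.2 p.1 * ζ p) ⊆ univ ×ˢ T :=
      (tsupport_mul_subset_right).trans hζT
    exact (continuous_mul_of_continuousOn_of_tsupport_subset_cs hO hvc (hQ.continuous.mul hζc')
      hs).integrable_of_hasCompactSupport hζc.mul_left.mul_left
  have hI6 : Integrable (fun p : M × ℝ ↦ G p.2 p.1 * ζ p) (μ₀.prod (volume : Measure ℝ)) :=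
    (hG.continuous.mul hζc').integrable_of_hasCompactSupport hζc.mul_left
  -- (I-t) integration by parts in time
  have hIt : ∫ p, v p * kt p ∂μ₀.prod (volume : Measure ℝ) =
      -∫ p : M × ℝ, deriv (fun s ↦ v (p.1, s)) p.2 * ζ p ∂μ₀.prod (volume : Measure ℝ) := by
    rw [integral_prod _ hI1, integral_prod _ hI2, ← integral_neg]
    refine integral_congr_ae (Eventually.of_forall fun y ↦ ?_)
    simp only
    obtain ⟨hkyc, hkyT⟩ := hasCompactSupport_slice_time hζc y hζT
    have hky : ContDiff ℝ 1 fun s ↦ ζ (y, s) := (contDiff_slice_time hζ y).of_le h1le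
    have hwc : ContinuousOn (fun s ↦ v (y, s)) T :=
      hvc.comp (continuous_const.prodMk continuous_id).continuousOn fun s hs ↦ ⟨mem_univ _, hs⟩
    have hw'c : ContinuousOn (fun s ↦ deriv (fun s' ↦ v (y, s')) s) T :=
      hDv.comp (continuous_const.prodMk continuous_id).continuousOn fun s hs ↦ ⟨mem_univ _, hs⟩
    exact integral_mul_deriv_eq_neg_of_tsupport_subset hT hwc hw'c (hvderiv y) hky hkyc hkyT
  -- (I-x) Green's identity in space (one factor compactly supported)
  have hIx : ∫ p, v p * kx p ∂μ₀.prod (volume : Measure ℝ) =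
      ∫ p : M × ℝ, g.laplaceBeltrami (fun x ↦ v (x, p.2)) p.1 * ζ p ∂μ₀.prod (volume : Measure ℝ) := by
    rw [integral_prod_symm _ hI3, integral_prod_symm _ hI4]
    refine integral_congr_ae (Eventually.of_forall fun σ ↦ ?_)
    simp only
    by_cases hσ : σ ∈ T
    · have hcomm := integral_mul_laplaceBeltrami_comm_of_hasCompactSupport_cs hg
        ((hvslice σ hσ).of_le h2le) ((hζslice σ).of_le h2le) (hasCompactSupport_slice_space_cs hζc σ)
      rw [hkx]
      refine hcomm.trans (integral_congr_ae (Eventually.of_forall fun y ↦ ?_))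
      simp only
      ring
    · have hz : (fun x ↦ ζ (x, σ)) = fun _ ↦ (0 : ℝ) := funext fun y ↦ hζT' σ hσ y
      refine integral_congr_ae (Eventually.of_forall fun y ↦ ?_)
      rw [hkx]
      simp only
      rw [hz, laplaceBeltrami_fun_zero, hζT' σ hσ y]
      ring
  -- assemble
  have hw := hweak ζ hζ hζc hζT
  have hlhs : ∫ p, v p * (-(deriv (fun s ↦ ζ (p.1, s)) p.2) -
      g.laplaceBeltrami (fun x ↦ ζ (x, p.2)) p.1 + Q p.2 p.1 * ζ p) ∂μ₀.prod (volume : Measure ℝ) =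
      -∫ p, v p * kt p ∂μ₀.prod (volume : Measure ℝ) - ∫ p, v p * kx p ∂μ₀.prod (volume : Measure ℝ)
        + ∫ p : M × ℝ, v p * (Q p.2 p.1 * ζ p) ∂μ₀.prod (volume : Measure ℝ) := by
    have e1 : ∫ p, v p * (-(deriv (fun s ↦ ζ (p.1, s)) p.2) -
        g.laplaceBeltrami (fun x ↦ ζ (x, p.2)) p.1 + Q p.2 p.1 * ζ p) ∂μ₀.prod (volume : Measure ℝ) =
        ∫ p : M × ℝ, ((-(v p * kt p) - v p * kx p) + v p * (Q p.2 p.1 * ζ p))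
          ∂μ₀.prod (volume : Measure ℝ) := by
      refine integral_congr_ae (Eventually.of_forall fun p ↦ ?_)
      rw [hkt, hkx]
      simp only
      ring
    have hA : Integrable (fun p : M × ℝ ↦ -(v p * kt p) - v p * kx p)
        (μ₀.prod (volume : Measure ℝ)) := hI1.fun_neg.sub hI3
    have hB : Integrable (fun p : M × ℝ ↦ -(v p * kt p)) (μ₀.prod (volume : Measure ℝ)) :=
      hI1.fun_neg
    rw [e1, integral_add hA hI5, integral_sub hB hI3, integral_neg]
  rw [hlhs, hIt, hIx, neg_neg] at hw
  -- `∫ W ζ = (∫ ∂v ζ) - (∫ Δv ζ) + (∫ v Q ζ) - ∫ G ζ = 0`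
  have hWζ : ∫ p, W p * ζ p ∂μ₀.prod (volume : Measure ℝ) =
      ∫ p : M × ℝ, deriv (fun s ↦ v (p.1, s)) p.2 * ζ p ∂μ₀.prod (volume : Measure ℝ)
      - ∫ p : M × ℝ, g.laplaceBeltrami (fun x ↦ v (x, p.2)) p.1 * ζ p ∂μ₀.prod (volume : Measure ℝ)
      + ∫ p : M × ℝ, v p * (Q p.2 p.1 * ζ p) ∂μ₀.prod (volume : Measure ℝ)
      - ∫ p : M × ℝ, G p.2 p.1 * ζ p ∂μ₀.prod (volume : Measure ℝ) := by
    have e2 : ∫ p, W p * ζ p ∂μ₀.prod (volume : Measure ℝ) =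
        ∫ p : M × ℝ, (((deriv (fun s ↦ v (p.1, s)) p.2 * ζ p
          - g.laplaceBeltrami (fun x ↦ v (x, p.2)) p.1 * ζ p)
          + v p * (Q p.2 p.1 * ζ p)) - G p.2 p.1 * ζ p) ∂μ₀.prod (volume : Measure ℝ) := by
      refine integral_congr_ae (Eventually.of_forall fun p ↦ ?_)
      rw [hW]
      simp only
      ring
    have hA : Integrable (fun p : M × ℝ ↦ deriv (fun s ↦ v (p.1, s)) p.2 * ζ p
        - g.laplaceBeltrami (fun x ↦ v (x, p.2)) p.1 * ζ p) (μ₀.prod (volume : Measure ℝ)) :=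
      hI2.sub hI4
    have hB : Integrable (fun p : M × ℝ ↦ (deriv (fun s ↦ v (p.1, s)) p.2 * ζ p
        - g.laplaceBeltrami (fun x ↦ v (x, p.2)) p.1 * ζ p) + v p * (Q p.2 p.1 * ζ p))
        (μ₀.prod (volume : Measure ℝ)) := hA.add hI5
    rw [e2, integral_sub hB hI6, integral_add hA hI5, integral_sub hI2 hI4]
  rw [hWζ]
  linarith [hw]

end ClassicalStatic

/-- **Registered helper `helper_classicalOfVeryWeak_noncompact`** (line `collapsed-ends-usc`): a function
`v` smooth on `M × T` (`T` open) which solves the static linear heat equation `∂ₛv − Δ_g v + Qv = G` in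
the very weak sense against all smooth compactly supported test functions supported in `M × T`, on a
(non-compact) Riemannian manifold `(M, g)` modelled on `ℝⁿ`, solves it pointwise on `M × T`
(`linearHeat_classical_of_veryWeak_static`). [cite: Evans2010, §7.1.1] -/
theorem helper_classicalOfVeryWeak_noncompact : ∀ (n : ℕ) (M : Type*) [TopologicalSpace M] [T2Space M] [SecondCountableTopology M] [ChartedSpace (EuclideanSpace ℝ (Fin n)) M] [IsManifold (𝓡 n) ∞ M] [T3Space M] [MeasurableSpace M] [BorelSpace M] (g : PseudoRiemannianMetric (𝓡 n) ∞ (EuclideanSpace ℝ (Fin n)) (TangentSpace (𝓡 n) : M → Type _)), g.IsRiemannian → ∀ (Q G : ℝ → M → ℝ), ContMDiff ((𝓡 n).prod 𝓘(ℝ, ℝ)) 𝓘(ℝ, ℝ) ∞ (fun p : M × ℝ ↦ Q p.2 p.1) → ContMDiff ((𝓡 n).prod 𝓘(ℝ, ℝ)) 𝓘(ℝ, ℝ) ∞ (fun p : M × ℝ ↦ G p.2 p.1) → ∀ (T : Set ℝ) (v : M × ℝ → ℝ), IsOpen T → ContMDiffOn ((𝓡 n).prod 𝓘(ℝ, ℝ))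 𝓘(ℝ, ℝ) ∞ v (univ ×ˢ T) → (∀ ζ : M × ℝ → ℝ, ContMDiff ((𝓡 n).prod 𝓘(ℝ, ℝ)) 𝓘(ℝ, ℝ) ∞ ζ → HasCompactSupport ζ → tsupport ζ ⊆ univ ×ˢ T → ∫ p, v p * (-(deriv (fun s ↦ ζ (p.1, s)) p.2) - g.laplaceBeltrami (fun x ↦ ζ (x, p.2)) p.1 + Q p.2 p.1 * ζ p) ∂(g.riemVolume.prod (volume : Measure ℝ)) = ∫ p, G p.2 p.1 * ζ p ∂(g.riemVolume.prod (volume : Measure ℝ))) → ∀ p ∈ univ ×ˢ T, deriv (fun s ↦ v (p.1, s)) p.2 - g.laplaceBeltrami (fun x ↦ v (x, p.2)) p.1 + Q p.2 p.1 * v p = G p.2 p.1 := by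
  intro n M _ _ _ _ _ _ _ _ g hg Q G hQ hG T v hT hv hweak
  exact linearHeat_classical_of_veryWeak_static hg hQ hG hT hv hweak

end Summit.SmoothPoincare4.SmoothPoincare4.Theorems.NoncompactShrinkerGapHeat

end
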